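import Summits.RiemannHypothesis.RiemannHypothesis.Theorems.WeilOffLineNoLever
import Literature.NumberTheory.LFunctions.WeilLogLatticeComb
import HarnessLib

/-!
# No lever above a verified height, to every order

Structure seat rh-explicit-weil-3 (gen6), supporting `stmt-RiemannHypothesis-0098`; sequel of
`WeilOffLineSplit.lean` (exact split `Re Q(g) = ∑ m‖(a+b)/2‖² − ∑ m‖(a−b)/2‖²`, `a = ĝ(ρ)`,
`b = ĝ(1 − ρ̄)`) and `WeilOffLineNoLever.lean` (order `k = 2` through `weilDecayConst`).
Everything PROVED. With `L_k(g) = weilL1 (deriv^[k] g) = ∫ ‖g^{(k)}(x)‖ e^{|x|/2} dx`: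

* `norm_offLine_le_of_iterate_deriv` — `‖(ĝ(ρ) − ĝ(1−ρ̄))/2‖ ≤ L_k(g)/|Im ρ|^k` at a non-trivial
  zero (from the tree's `weilMellin_iterate_deriv`, `norm_weilMellin_le_weilL1_iterate_deriv_div`:
  `(g^{(k)})^(s) = (−(s − 1/2))^k ĝ(s)`, `‖ĝ(s)‖ ≤ L_k(g)/|Im s|^k`).
* `neg_le_re_weilQuadratic_of_rh_upTo_order` — **NO LEVER, TO EVERY ORDER**: if every non-trivial
  zero with `|Im ρ| ≤ T₀` (`T₀ ≥ 1`) lies on the line then, for every test function and every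
  `k ≥ 1`, `Re Q(g) ≥ −(463/5000) · L_k(g)² · T₀² / T₀^{2k}` (one term:
  `offLine_term_le_of_rh_upTo_order`; Ford's `∑ m/|ρ|² ≤ 0.0463`).
* `neg_le_re_weilQuadratic_plattTrudgian_order` — the same at `T₀ = 3 000 175 332 800` with the
  Platt–Trudgian height as an inlined hypothesis (`T₀²/T₀^{2k} ≤ 10^{−24(k−1)}`).

Reading: at a FIXED test function the off-line world acts on Weil's form only through the spectral
content of `g` above the verified height — the budget is `O_k(L_k(g)² T₀^{2−2k})` for every `k`,
i.e. smaller than any power of `T₀`. For the ladder's extremal functions (effective bandwidth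
`≈ 11 e^{2t} ≤ 10³ ≪ T₀`) it is zero to hundreds of digits; a negativity witness must put its
energy at frequencies `≳ T₀`. References: Bombieri 2000 §13; Ford 2002 Lemma 3.3; Platt–Trudgian
2021 (the height, hypothesis only).
-/

noncomputable section

set_option linter.dupNamespace false  -- the mandated namespace repeats `RiemannHypothesis`

open Complex Filter Set MeasureTheory Topology
open scoped Real ComplexConjugate

namespace Summit.RiemannHypothesis.RiemannHypothesis.Theorems.WeilOffLine

open Literature.NumberTheory.LFunctions Literature.NumberTheory.LFunctions.WeilConverse

/-! ### Decay of the transform from `k` derivatives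

`k` integrations by parts, `(g^{(k)})^(s) = (−(s − 1/2))^k ĝ(s)`, and the strip bound
`‖ĝ(s)‖ ≤ L_k(g)/|Im s|^k` are the tree's `weilMellin_iterate_deriv`,
`norm_weilMellin_le_weilL1_iterate_deriv_div` (`WeilLogLatticeComb.lean`). -/

/-- The off-line part at a non-trivial zero, from `k` derivatives:
`‖(ĝ(ρ) − ĝ(1−ρ̄))/2‖ ≤ (∫ ‖g^{(k)}‖ e^{|x|/2}) / |Im ρ|^k`. [folklore] -/
theorem norm_offLine_le_of_iterate_deriv {g : ℝ → ℂ} (hg : IsWeilTest g) (k : ℕ) {ρ : ℂ}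
    (hρ : ρ ∈ ZetaZeros.riemannZetaNontrivialZeros) :
    ‖(weilMellin g ρ - weilMellin g (1 - conj ρ)) / 2‖ ≤ weilL1 (deriv^[k] g) / |ρ.im| ^ k := by
  have h0 := ZetaZeros.riemannZetaNontrivialZeros.re_pos hρ
  have h1 := ZetaZeros.riemannZetaNontrivialZeros.re_lt_one hρ
  have him := ZetaZeros.riemannZetaNontrivialZeros.im_ne_zero hρ
  have ha := norm_weilMellin_le_weilL1_iterate_deriv_div hg k h0.le h1.le him
  have hb : ‖weilMellin g (1 - conj ρ)‖ ≤ weilL1 (deriv^[k] g) / |ρ.im| ^ k := by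
    have := norm_weilMellin_le_weilL1_iterate_deriv_div hg k (s := 1 - conj ρ)
      (by rw [one_sub_conj_re]; linarith) (by rw [one_sub_conj_re]; linarith)
      (by rw [one_sub_conj_im]; exact him)
    rwa [one_sub_conj_im] at this
  rw [norm_div, Complex.norm_ofNat]
  linarith [norm_sub_le (weilMellin g ρ) (weilMellin g (1 - conj ρ))]

/-! ### No lever above a verified height, to every order -/

/-- One term, to order `k ≥ 1`: if every non-trivial zero with `|Im ρ| ≤ T₀` (`T₀ ≥ 1`) lies on
the line, then `m(ρ) ‖(ĝ(ρ) − ĝ(1−ρ̄))/2‖² ≤ (2 L_k² T₀² / T₀^{2k}) · m(ρ)/|ρ|²` with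
`L_k = ∫ ‖g^{(k)}‖ e^{|x|/2}` (the term vanishes below the height; above it
`|γ|^{2k} ≥ T₀^{2k−2} γ²` and `γ² ≥ |ρ|²/2`). [folklore] -/
theorem offLine_term_le_of_rh_upTo_order {g : ℝ → ℂ} (hg : IsWeilTest g) {k : ℕ} (hk : 1 ≤ k)
    {T₀ : ℝ} (hT₀ : 1 ≤ T₀)
    (hRH : ∀ ρ ∈ ZetaZeros.riemannZetaNontrivialZeros, |ρ.im| ≤ T₀ → ρ.re = 1 / 2)
    (ρ : ZetaZeros.riemannZetaNontrivialZeros) :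
    (riemannZetaZeroOrder (ρ : ℂ) : ℝ) *
        ‖(weilMellin g ρ - weilMellin g (1 - conj (ρ : ℂ))) / 2‖ ^ 2 ≤
      2 * weilL1 (deriv^[k] g) ^ 2 * T₀ ^ 2 / T₀ ^ (2 * k) *
        ((riemannZetaZeroOrder (ρ : ℂ) : ℝ) / ‖(ρ : ℂ)‖ ^ 2) := by
  have hm : (0 : ℝ) ≤ riemannZetaZeroOrder (ρ : ℂ) := by
    exact_mod_cast riemannZetaZeroOrder_nonneg (ZetaZeros.riemannZetaNontrivialZeros.ne_one ρ.2)
  have h0 := ZetaZeros.riemannZetaNontrivialZeros.re_pos ρ.2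
  have h1 := ZetaZeros.riemannZetaNontrivialZeros.re_lt_one ρ.2
  have hT : 0 < T₀ := by linarith
  have hρ0 : 0 < ‖(ρ : ℂ)‖ ^ 2 := by
    have : (ρ : ℂ) ≠ 0 := fun h ↦ by rw [h, Complex.zero_re] at h0; exact lt_irrefl _ h0
    positivity
  have hRHS : 0 ≤ 2 * weilL1 (deriv^[k] g) ^ 2 * T₀ ^ 2 / T₀ ^ (2 * k) *
      ((riemannZetaZeroOrder (ρ : ℂ) : ℝ) / ‖(ρ : ℂ)‖ ^ 2) :=
    mul_nonneg (div_nonneg (by positivity) (by positivity)) (div_nonneg hm hρ0.le)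
  by_cases hγ : |(ρ : ℂ).im| ≤ T₀
  · rw [weilMellin_sub_reflect_eq_zero g (hRH ρ ρ.2 hγ), zero_div, norm_zero,
      zero_pow two_ne_zero, mul_zero]
    exact hRHS
  · push Not at hγ
    set L := weilL1 (deriv^[k] g) with hL
    have hL0 : 0 ≤ L := weilL1_nonneg _
    have hγpos : 0 < |(ρ : ℂ).im| := by linarith
    have hD := norm_offLine_le_of_iterate_deriv hg k ρ.2
    have hD2 : ‖(weilMellin g ρ - weilMellin g (1 - conj (ρ : ℂ))) / 2‖ ^ 2 ≤
        L ^ 2 / (|(ρ : ℂ).im| ^ k) ^ 2 := by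
      rw [← div_pow]; exact pow_le_pow_left₀ (norm_nonneg _) hD 2
    -- `|γ|^{2k} ≥ T₀^{2k-2} · γ²` and `γ² ≥ |ρ|²/2`
    have hγ1 : 1 ≤ |(ρ : ℂ).im| := hT₀.trans hγ.le
    have him2 : 1 ≤ (ρ : ℂ).im ^ 2 := by
      have := pow_le_pow_left₀ zero_le_one hγ1 2
      simpa [sq_abs] using this
    have hnorm : ‖(ρ : ℂ)‖ ^ 2 ≤ 2 * |(ρ : ℂ).im| ^ 2 := by
      rw [← Complex.normSq_eq_norm_sq, Complex.normSq_apply, sq_abs]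
      nlinarith
    have hpow : T₀ ^ (2 * k) * ‖(ρ : ℂ)‖ ^ 2 ≤ 2 * T₀ ^ 2 * (|(ρ : ℂ).im| ^ k) ^ 2 := by
      have hk1 : 2 * k = 2 * (k - 1) + 2 := by omega
      have hTk : T₀ ^ (2 * (k - 1)) ≤ |(ρ : ℂ).im| ^ (2 * (k - 1)) :=
        pow_le_pow_left₀ hT.le hγ.le _
      have e : (|(ρ : ℂ).im| ^ k) ^ 2 = |(ρ : ℂ).im| ^ (2 * (k - 1)) * |(ρ : ℂ).im| ^ 2 := by
        rw [← pow_mul, ← pow_add]; congr 1; omega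
      rw [hk1, pow_add, e]
      have hT2 : 0 ≤ T₀ ^ 2 := sq_nonneg _
      calc T₀ ^ (2 * (k - 1)) * T₀ ^ 2 * ‖(ρ : ℂ)‖ ^ 2
          ≤ |(ρ : ℂ).im| ^ (2 * (k - 1)) * T₀ ^ 2 * (2 * |(ρ : ℂ).im| ^ 2) := by
            apply mul_le_mul (mul_le_mul_of_nonneg_right hTk hT2) hnorm hρ0.le
            positivity
        _ = 2 * T₀ ^ 2 * (|(ρ : ℂ).im| ^ (2 * (k - 1)) * |(ρ : ℂ).im| ^ 2) := by ring
    have hfrac : L ^ 2 / (|(ρ : ℂ).im| ^ k) ^ 2 ≤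
        2 * L ^ 2 * T₀ ^ 2 / T₀ ^ (2 * k) * (1 / ‖(ρ : ℂ)‖ ^ 2) := by
      rw [div_mul_div_comm, mul_one, div_le_div_iff₀ (by positivity) (by positivity)]
      calc L ^ 2 * (T₀ ^ (2 * k) * ‖(ρ : ℂ)‖ ^ 2)
          ≤ L ^ 2 * (2 * T₀ ^ 2 * (|(ρ : ℂ).im| ^ k) ^ 2) :=
            mul_le_mul_of_nonneg_left hpow (sq_nonneg _)
        _ = 2 * L ^ 2 * T₀ ^ 2 * (|(ρ : ℂ).im| ^ k) ^ 2 := by ring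
    calc (riemannZetaZeroOrder (ρ : ℂ) : ℝ) *
          ‖(weilMellin g ρ - weilMellin g (1 - conj (ρ : ℂ))) / 2‖ ^ 2
        ≤ (riemannZetaZeroOrder (ρ : ℂ) : ℝ) *
            (2 * L ^ 2 * T₀ ^ 2 / T₀ ^ (2 * k) * (1 / ‖(ρ : ℂ)‖ ^ 2)) :=
          mul_le_mul_of_nonneg_left (hD2.trans hfrac) hm
      _ = _ := by ring

/-- **NO LEVER ABOVE A VERIFIED HEIGHT, TO EVERY ORDER**: if every non-trivial zero of `ζ` with
`|Im ρ| ≤ T₀` (`T₀ ≥ 1`) lies on the critical line, then for every test function `g` and every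
`k ≥ 1`, `Re Q(g) ≥ −(463/5000) · (∫ ‖g^{(k)}‖ e^{|x|/2})² · T₀² / T₀^{2k}` (Ford's
`∑ m(ρ)/|ρ|² ≤ 0.0463`). The off-line world can lower Weil's form at a FIXED test function only
through the spectral content of `g` above the verified height: the bound decays faster than any
power of `T₀`. [folklore] -/
theorem neg_le_re_weilQuadratic_of_rh_upTo_order {g : ℝ → ℂ} (hg : IsWeilTest g) {k : ℕ}
    (hk : 1 ≤ k) {T₀ : ℝ} (hT₀ : 1 ≤ T₀)
    (hRH : ∀ ρ ∈ ZetaZeros.riemannZetaNontrivialZeros, |ρ.im| ≤ T₀ → ρ.re = 1 / 2) :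
    -(463 / 5000 * weilL1 (deriv^[k] g) ^ 2 * T₀ ^ 2 / T₀ ^ (2 * k)) ≤ (weilQuadratic g).re := by
  have h1 := neg_tsum_le_re_weilQuadratic hg
  have h2 : ∑' ρ : ZetaZeros.riemannZetaNontrivialZeros,
      (riemannZetaZeroOrder (ρ : ℂ) : ℝ) *
        ‖(weilMellin g ρ - weilMellin g (1 - conj (ρ : ℂ))) / 2‖ ^ 2 ≤
      2 * weilL1 (deriv^[k] g) ^ 2 * T₀ ^ 2 / T₀ ^ (2 * k) *
        ∑' ρ : ZetaZeros.riemannZetaNontrivialZeros,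
          (riemannZetaZeroOrder (ρ : ℂ) : ℝ) / ‖(ρ : ℂ)‖ ^ 2 := by
    rw [← tsum_mul_left]
    exact (summable_offLine hg).tsum_le_tsum (offLine_term_le_of_rh_upTo_order hg hk hT₀ hRH)
      (FordL33.summable_order_div_norm_sq.mul_left _)
  have h3 : ∑' ρ : ZetaZeros.riemannZetaNontrivialZeros,
      (riemannZetaZeroOrder (ρ : ℂ) : ℝ) / ‖(ρ : ℂ)‖ ^ 2 ≤ 0.0463 :=
    tsum_zeroOrder_div_norm_sq_le
  have hC : 0 ≤ 2 * weilL1 (deriv^[k] g) ^ 2 * T₀ ^ 2 / T₀ ^ (2 * k) :=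
    div_nonneg (by positivity) (by positivity)
  have h4 := mul_le_mul_of_nonneg_left h3 hC
  have h5 : 2 * weilL1 (deriv^[k] g) ^ 2 * T₀ ^ 2 / T₀ ^ (2 * k) * 0.0463 =
      463 / 5000 * weilL1 (deriv^[k] g) ^ 2 * T₀ ^ 2 / T₀ ^ (2 * k) := by ring
  linarith

/-- At the Platt–Trudgian height (hypothesis inlined as in `WeilAdversary.AdversaryTransfer`), to
every order `k ≥ 1`: `Re Q(g) ≥ −(463/5000)·(∫‖g^{(k)}‖e^{|x|/2})²·T₀²/T₀^{2k}`,
`T₀ = 3 000 175 332 800`; e.g. `T₀²/T₀^{2k} ≤ 10^{−24(k−1)}`. [folklore] -/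
theorem neg_le_re_weilQuadratic_plattTrudgian_order
    (h : ∀ s : ℂ, riemannZeta s = 0 → 0 < s.im → s.im ≤ 3000175332800 → s.re = 1 / 2)
    {g : ℝ → ℂ} (hg : IsWeilTest g) {k : ℕ} (hk : 1 ≤ k) :
    -(463 / 5000 * weilL1 (deriv^[k] g) ^ 2 *
        (3000175332800 : ℝ) ^ 2 / (3000175332800 : ℝ) ^ (2 * k)) ≤ (weilQuadratic g).re :=
  neg_le_re_weilQuadratic_of_rh_upTo_order hg hk (T₀ := 3000175332800) (by norm_num)
    (rh_upTo_of_upper h)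

end Summit.RiemannHypothesis.RiemannHypothesis.Theorems.WeilOffLine

end
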